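import Literature.AlgebraicGeometry.Resolution.FrobeniusNormIdeal
import Mathlib.RingTheory.Localization.FractionRing
import HarnessLib

/-!
# Transport of Frobenius norm ideals along isomorphisms of the fraction field (`IsFrobeniusNormIdeal` does not depend on the chosen fraction field)
# (crux `FInjectiveMacaulayfication` stmt-ResolutionOfSingularities-15315, chain w45a; res-L1-w45a-plan-1 GO (K) 06:26:45Z: the piece res-L1-w45a-lead-1's TIER-2 discharge
# of LEMMA N needs to move a norm computed over ONE concrete fraction field to the `X.functionField` of the F-blowup binder; seat res-L1-w45a-stub-1 g9)

[OURS · L1 W4.5a] Support file (`--supports stmt-ResolutionOfSingularities-15315 --as helper`); generic (Literature-grade content about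
`Literature.AlgebraicGeometry.Resolution.IsFrobeniusNormIdeal`, kept here as a chain helper; the desk may re-home it); def-free, unconditional. AI-written (AI review is weaker
than expert review).

* `IsFrobeniusNormIdeal.of_algEquiv` — for an `A`-algebra isomorphism `φ : K ≃ₐ[A] K′` of fields of exponential characteristic `p`:
  `IsFrobeniusNormIdeal K p e I → IsFrobeniusNormIdeal K′ p e I`. Proof: `φ` maps the subfield `K^q` onto `K′^q`; the `K^q`-basis `β` of `K` goes to the `K′^q`-basis
  `β′ = φ ∘ β` of `K′` (`Basis.mk`), with `β′.repr (φ x) = φ ∘ β.repr x`, hence `det_{β′}(φ ∘ m) = φ(det_β m)` (`RingHom.map_det`); so the norm SET of `β′` is `φ` of the norm set of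
  `β`, the norm MODULE is its image, and so is `I·K′ = φ(I·K)`.
* `isFrobeniusNormIdeal_iff_of_algEquiv`; ★ `isFrobeniusNormIdeal_iff_of_isFractionRing` — any two fraction fields of the domain `A` give the same predicate
  (`IsLocalization.algEquiv`).

[folklore; cite: Villamayoru2006, §2 p. 123 (the norm is well defined up to the identification `⋀ʳ M ⊗ K ≅ K`)]
-/

noncomputable section

open Literature.AlgebraicGeometry.Resolution

namespace Summit.ResolutionOfSingularities.ResolutionOfSingularities.Theorems.FInjectiveMacaulayfication.FrobeniusNormTransport

set_option linter.dupNamespace false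

universe u

variable {A : Type u} [CommRing A] {K K' : Type u} [Field K] [Field K'] [Algebra A K] [Algebra A K']
  {p : ℕ} [ExpChar K p] [ExpChar K' p] {e : ℕ}

/-- `φ` maps `q`-th powers to `q`-th powers: `φ(K^q) ⊆ K′^q`. [folklore] -/
theorem map_mem_iterateFrobeniusRange (φ : K ≃ₐ[A] K') {x : K} (hx : x ∈ iterateFrobeniusRange K p e) :
    φ x ∈ iterateFrobeniusRange K' p e := by
  obtain ⟨y, rfl⟩ := mem_iterateFrobeniusRange_iff.mp hx
  exact mem_iterateFrobeniusRange_iff.mpr ⟨φ y, by rw [map_pow]⟩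

/-- **Transport of `IsFrobeniusNormIdeal` along an `A`-algebra isomorphism of the field.** [folklore; cite: Villamayoru2006, §2 p. 123] -/
theorem IsFrobeniusNormIdeal.of_algEquiv (φ : K ≃ₐ[A] K') {I : Ideal A} (h : IsFrobeniusNormIdeal K p e I) :
    IsFrobeniusNormIdeal K' p e I := by
  classical
  obtain ⟨ι, hfin, hdec, β, hβ⟩ := h
  -- the restricted isomorphisms `ψ : K^q → K′^q`, `ψ' : K′^q → K^q`
  let ψ : iterateFrobeniusRange K p e →+* iterateFrobeniusRange K' p e :=
    ((φ : K ≃ₐ[A] K').toRingEquiv.toRingHom.comp (iterateFrobeniusRange K p e).subtype).codRestrict _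
      (fun c => map_mem_iterateFrobeniusRange φ c.2)
  have hψ : ∀ c : iterateFrobeniusRange K p e, ((ψ c : iterateFrobeniusRange K' p e) : K') = φ (c : K) := fun c => rfl
  let ψ' : iterateFrobeniusRange K' p e →+* iterateFrobeniusRange K p e :=
    ((φ.symm : K' ≃ₐ[A] K).toRingEquiv.toRingHom.comp (iterateFrobeniusRange K' p e).subtype).codRestrict _
      (fun c => map_mem_iterateFrobeniusRange φ.symm c.2)
  have hψ' : ∀ c : iterateFrobeniusRange K' p e, ((ψ' c : iterateFrobeniusRange K p e) : K) = φ.symm (c : K') := fun c => rfl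
  have hψψ' : ∀ c, ψ (ψ' c) = c := fun c => Subtype.ext (by rw [hψ, hψ']; exact φ.apply_symm_apply _)
  -- smul by the subfield is multiplication by the coercion
  have hsmul : ∀ (c : iterateFrobeniusRange K p e) (x : K), c • x = (c : K) * x := fun c x => rfl
  have hsmul' : ∀ (c : iterateFrobeniusRange K' p e) (x : K'), c • x = (c : K') * x := fun c x => rfl
  -- `φ` of a coordinate expansion
  have hφsum : ∀ (c : ι → iterateFrobeniusRange K p e), φ (∑ i, c i • β i) = ∑ i, ψ (c i) • φ (β i) := by
    intro c
    rw [map_sum]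
    refine Finset.sum_congr rfl fun i _ => ?_
    rw [hsmul, hsmul', map_mul, hψ]
  -- the transported family `φ ∘ β` is a `K′^q`-basis of `K′`
  have hli : LinearIndependent (iterateFrobeniusRange K' p e) (fun i => φ (β i)) := by
    rw [Fintype.linearIndependent_iff]
    intro g hg i
    -- apply `φ⁻¹`: `Σ ψ'(gᵢ) • βᵢ = 0`
    have h0 : ∑ j, ψ' (g j) • β j = 0 := by
      apply φ.injective
      rw [hφsum, map_zero, ← hg]
      exact Finset.sum_congr rfl fun j _ => by rw [hψψ']
    have := (Fintype.linearIndependent_iff.mp β.linearIndependent) (fun j => ψ' (g j)) h0 i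
    have h1 : ψ (ψ' (g i)) = ψ 0 := by rw [this]
    rwa [hψψ', map_zero] at h1
  have hsp : ⊤ ≤ Submodule.span (iterateFrobeniusRange K' p e) (Set.range fun i => φ (β i)) := by
    rintro x' -
    obtain ⟨x, rfl⟩ := φ.surjective x'
    rw [← β.sum_repr x, hφsum]
    exact Submodule.sum_mem _ fun i _ => Submodule.smul_mem _ _ (Submodule.subset_span ⟨i, rfl⟩)
  let β' : Module.Basis ι (iterateFrobeniusRange K' p e) K' := Module.Basis.mk hli hsp
  have hβ'apply : ∀ i, β' i = φ (β i) := fun i => Module.Basis.mk_apply hli hsp i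
  -- coordinates transport: `β′.repr (φ x) i = ψ (β.repr x i)`
  have hrepr : ∀ (x : K) (i : ι), β'.repr (φ x) i = ψ (β.repr x i) := by
    intro x i
    have hx : φ x = ∑ j, ψ (β.repr x j) • β' j := by
      conv_lhs => rw [← β.sum_repr x]
      rw [hφsum]
      exact Finset.sum_congr rfl fun j _ => by rw [hβ'apply]
    rw [hx, β'.repr_sum_self]
  -- determinants transport: `det_{β′}(φ ∘ m) = ψ (det_β m)`
  have hdet : ∀ m : ι → K, β'.det (fun i => φ (m i)) = ψ (β.det m) := by
    intro m
    rw [Module.Basis.det_apply, Module.Basis.det_apply, RingHom.map_det]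
    congr 1
    ext i j
    rw [RingHom.mapMatrix_apply, Matrix.map_apply, Module.Basis.toMatrix_apply, Module.Basis.toMatrix_apply, hrepr]
  -- the norm set transports: `normSet β′ = φ '' normSet β`
  have hφalg : ∀ a : A, φ (algebraMap A K a) = algebraMap A K' a := fun a => φ.commutes a
  have hset : frobeniusNormSet β' A = φ '' frobeniusNormSet β A := by
    ext d'
    rw [mem_frobeniusNormSet_iff, Set.mem_image]
    constructor
    · rintro ⟨m, hm⟩
      refine ⟨φ.symm d', mem_frobeniusNormSet_iff.mpr ⟨m, ?_⟩, φ.apply_symm_apply d'⟩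
      apply φ.injective
      rw [map_pow, φ.apply_symm_apply, hm, ← hψ, ← hdet]
      congr 2
      funext i
      rw [hφalg]
    · rintro ⟨d, hd, rfl⟩
      obtain ⟨m, hm⟩ := mem_frobeniusNormSet_iff.mp hd
      refine ⟨m, ?_⟩
      rw [← map_pow, hm, ← hψ, ← hdet]
      congr 2
      funext i
      rw [hφalg]
  -- the norm module and `I · K` transport as images under `φ`
  refine ⟨ι, hfin, hdec, β', ?_⟩
  have hcoe : IsLocalization.coeSubmodule K' I = (IsLocalization.coeSubmodule K I).map (φ.toLinearEquiv : K ≃ₗ[A] K').toLinearMap := by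
    rw [IsLocalization.coeSubmodule, IsLocalization.coeSubmodule, ← Submodule.map_comp]
    congr 1
    ext
    simp
  rw [hcoe, hβ, frobeniusNorm, frobeniusNorm, Submodule.map_span, hset]
  rfl

/-- **`IsFrobeniusNormIdeal` is invariant under `A`-algebra isomorphisms of the field.** [folklore] -/
theorem isFrobeniusNormIdeal_iff_of_algEquiv (φ : K ≃ₐ[A] K') (I : Ideal A) :
    IsFrobeniusNormIdeal K p e I ↔ IsFrobeniusNormIdeal K' p e I :=
  ⟨IsFrobeniusNormIdeal.of_algEquiv φ, IsFrobeniusNormIdeal.of_algEquiv φ.symm⟩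

/-- ★ **Any two fraction fields of a domain give the same `IsFrobeniusNormIdeal` predicate** (they are isomorphic `A`-algebras, `IsLocalization.algEquiv`).
[folklore; cite: Villamayoru2006, §2 p. 123] -/
theorem isFrobeniusNormIdeal_iff_of_isFractionRing [IsDomain A] [IsFractionRing A K] [IsFractionRing A K'] (I : Ideal A) :
    IsFrobeniusNormIdeal K p e I ↔ IsFrobeniusNormIdeal K' p e I :=
  isFrobeniusNormIdeal_iff_of_algEquiv (IsLocalization.algEquiv (nonZeroDivisors A) K K') I

end Summit.ResolutionOfSingularities.ResolutionOfSingularities.Theorems.FInjectiveMacaulayfication.FrobeniusNormTransport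

end
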